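import Literature.AlgebraicGeometry.PlaneCurves.HessePencilGroupLaw
import HarnessLib

/-!
# The eight cubics `B₁, …, B₈` cut out the points of order `9` (Artebani–Dolgachev, Prop. 5.2, first assertion)

Topic `Literature/AlgebraicGeometry/PlaneCurves`, namespace `Literature.AlgebraicGeometry.PlaneCurves`.
Lane `lit-hodgefound`, seat `lit-hodgefound-p37`, row g20-#4; the sequel of `HessePencilGroupLaw`
(g20-#3: `g₂ = +T₁`, `t₃ = +T₃` in the group of the Weierstrass model read through `N_μ`),
`HessePencilTranslationIncidences` (g20-#2: `⟨∇H_μ(p), τ p⟩ = c_τ · B_τ(p)` for the eight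
non-trivial translations `τ = g₂^a t₃^b`) and `WeierstrassLineIntersectionCycle` (g20-#1: the
tangent at `P` passes through `Q` iff `Q = P` or `2P + Q = O`).  `HessePencilEightCubics` (g19-#3)
listed "the first assertion of Prop. 5.2 (the `Bᵢ` cut out the points of order `9` — the group
law)" as NOT there; here it is.  Everything is PROVED; no definition, no named fact.

Source followed — M. Artebani, I. Dolgachev, *The Hesse pencil of plane cubic curves*,
L'Enseignement Math. (2) 55 (2009) 235–273, §5, Prop. 5.2 and its proof [arXiv:math/0611590, held
`paper:arxiv-math_0611590` p0010 L45–L54, p0011 L1–L16], VERBATIM: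

> **Proposition 5.2.** The curves `Bᵢ […]`, `i = 1, …, 8`, are plane cubic curves with equations
> `B₁ : x³ + εy³ + ε²z³ = 0`, `B₅ : x³ + ε²y³ + εz³ = 0`, `B₂ : x²y + y²z + z²x = 0`,
> `B₆ : x²z + y²x + z²y = 0`, `B₃ : x²y + ε²y²z + εz²x = 0`, `B₇ : x²z + εy²x + ε²z²y = 0`,
> `B₄ : x²y + εy²z + ε²z²x = 0`, `B₈ : x²z + ε²y²x + εz²y = 0`. The union of the eight cubics `Bᵢ`
> cuts out on each nonsingular member of the Hesse pencil the set of points of order `9` in the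
> group law with the point `p₀` as the origin. […]
> *Proof.* […] It follows from the definition of the group law that we have
> `2p ⊕ q = 2q ⊕ r = 2r ⊕ s = 0`. This immediately implies that `9p = 0` if and only if `p = s`
> […] The point `q = (x₀, εy₀, ε²z₀)` lies on `E` […] it also lies on the tangent line at `p` if
> `p = (x₀, y₀, z₀)` satisfies the equation `B₁ : x³ + εy³ + ε²z³ = 0`. […] Hence we see that any
> point in `B₁ ∩ E` is a point of order `9`. Now we apply the elements of the Hessian group to the
> curve `B₁` to get the remaining cubic curves `B₂, …, B₈`.

## The argument, in the group

With `p = N vec P` the point of `H_μ` of `P ∈ W_μ(K)` (g20-#3), the printed `q = (x₀, εy₀, ε²z₀)` is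
`g₂ p`, i.e. the point of `P + T₁` (`hesse_translation_g₂_iff`); "`q` lies on the tangent at `p`" is
`⟨∇H_μ(p), g₂ p⟩ = 0`, which is `3·B₁(p) = 0` (g20-#2); and by g20-#1 the tangent at `P` contains
`P + T₁ ≠ P` iff `2P + (P + T₁) = O`, i.e. `3P = −T₁`.  So **`B₁(p) = 0` iff `3P + T₁ = O`**, and
then `9P = O`, `3P ≠ O`: `P` has order exactly `9`.  The same with the translation `g₂^a t₃^b` by
`aT₁ + bT₃` and the matching cubic gives all eight: **`p ∈ B_{i(a,b)}` iff `3P + aT₁ + bT₃ = O`**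
— each `Bᵢ` cuts out one coset of `E[3]` in the `72` points of order `9`, the union all of them.

## What is here (`K` a field, `3 ≠ 0`, `μ³ ≠ 1`, `ω² + ω + 1 = 0`, `T₁, T₃` over `p₁, p₃`)

* §1 `hesse_tangent_contains_translate_iff` — for a translation `τ` by `T ≠ O`
  (`N vec (P + T) ∥ τ(N vec P)` for all `P`): `⟨∇H_μ(N vec P), τ(N vec P)⟩ = 0` iff `3P + T = O`.
* §2 the eight translations `g₂^a t₃^b` (`(a, b) ≠ (0, 0)`) by `aT₁ + bT₃`, composed from g20-#3,
  and `aT₁ + bT₃ ≠ O` for them (`hesse_torsion_ne_zero`).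
* §3 **Prop. 5.2, first assertion, cubic by cubic** (`hesse_B_eq_zero_iff`): for `P ∈ W_μ(K)` with
  Hesse point `p = N vec P`: `B₁(p) = 0 ↔ 3P + T₁ = O`, `B₅(p) = 0 ↔ 3P + 2T₁ = O`,
  `B₆(p) = 0 ↔ 3P + T₃ = O`, `B₂(p) = 0 ↔ 3P + 2T₃ = O`, `B₇(p) = 0 ↔ 3P + T₁ + T₃ = O`,
  `B₈(p) = 0 ↔ 3P + 2T₁ + T₃ = O`, `B₄(p) = 0 ↔ 3P + T₁ + 2T₃ = O`,
  `B₃(p) = 0 ↔ 3P + 2T₁ + 2T₃ = O`.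
* §4 **"cuts out … the set of points of order 9"** (`addOrderOf_eq_nine_of_three_nsmul_add`,
  `hesse_addOrderOf_eq_nine`): a point of `H_μ(K)` on any of the eight cubics has order exactly `9`
  in `W_μ(K)`; conversely the `←` directions of §3 put every `P` with `3P = −(aT₁ + bT₃)`,
  `(a, b) ≠ (0, 0)`, on the matching cubic — which is every point of order `9` as soon as
  `W_μ(K)[3] = {aT₁ + bT₃}` (e.g. `K = K̄`, `#W_μ(K)[3] = 9`, `WeierstrassNineFlexes`; not repeated).

## References
* [ArtebaniDolgachev2009] M. Artebani, I. Dolgachev, *The Hesse pencil of plane cubic curves*,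
  Enseign. Math. (2) 55 (2009) 235–273, §5, Prop. 5.2 (the Halphen cubics and the points of order
  `9`) and its proof.
* [Kunz2005PlaneAlgebraicCurves] E. Kunz, *Introduction to Plane Algebraic Curves*, Birkhäuser
  2005, Ch. 10, Cor. 10.7.
-/

set_option autoImplicit false

open MvPolynomial Matrix

namespace Literature.AlgebraicGeometry.PlaneCurves

universe u

/-- The Hesse cubic `H_μ = X³ + Y³ + Z³ − 3μXYZ` (local notation, no definition). -/
local notation3 "𝐇[" μ "]" =>
  (X 0 ^ 3 + X 1 ^ 3 + X 2 ^ 3 - C (3 * μ) * (X 0 * X 1 * X 2) : MvPolynomial (Fin 3) _)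

/-- The Weierstrass model `W_μ` of `H_μ` (local notation). -/
local notation3 "𝐖[" μ "]" =>
  ({ a₁ := -μ, a₂ := -μ ^ 2, a₃ := (μ ^ 3 - 1) / 3, a₄ := μ * (μ ^ 3 - 1) / 3,
     a₆ := -(μ ^ 3 - 1) ^ 2 / 27 } : WeierstrassCurve _)

/-- `N_μ = [[1, 0, 0], [−μ, 1, (μ³−1)/3], [0, −1, 0]]` (g20-#3; local notation). -/
local notation3 "𝐍[" μ "]" =>
  (Matrix.of ![![1, 0, 0], ![-μ, 1, (μ ^ 3 - 1) / 3], ![0, -1, 0]] : Matrix (Fin 3) (Fin 3) _)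

/-- `g₂ = diag(1, ε, ε²)` and `t₃ = (z, x, y)` (local notations, no definitions). -/
local notation3 "𝐠₂[" ω "]" =>
  (Matrix.of ![![(1 : _), 0, 0], ![0, ω, 0], ![0, 0, ω ^ 2]] : Matrix (Fin 3) (Fin 3) _)
local notation3 "𝐭₃" => (Matrix.of ![![(0 : _), 0, 1], ![1, 0, 0], ![0, 1, 0]] : Matrix (Fin 3) (Fin 3) _)

/-- The eight cubics of Prop. 5.2, as printed (local notations as in `HessePencilEightCubics`,
no definitions). -/
local notation3 "𝐁₁[" ω "]" => (X 0 ^ 3 + C ω * X 1 ^ 3 + C (ω ^ 2) * X 2 ^ 3 : MvPolynomial (Fin 3) _)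
local notation3 "𝐁₅[" ω "]" => (X 0 ^ 3 + C (ω ^ 2) * X 1 ^ 3 + C ω * X 2 ^ 3 : MvPolynomial (Fin 3) _)
local notation3 "𝐁₂" => (X 0 ^ 2 * X 1 + X 1 ^ 2 * X 2 + X 2 ^ 2 * X 0 : MvPolynomial (Fin 3) _)
local notation3 "𝐁₆" => (X 0 ^ 2 * X 2 + X 1 ^ 2 * X 0 + X 2 ^ 2 * X 1 : MvPolynomial (Fin 3) _)
local notation3 "𝐁₃[" ω "]" =>
  (X 0 ^ 2 * X 1 + C (ω ^ 2) * (X 1 ^ 2 * X 2) + C ω * (X 2 ^ 2 * X 0) : MvPolynomial (Fin 3) _)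
local notation3 "𝐁₇[" ω "]" =>
  (X 0 ^ 2 * X 2 + C ω * (X 1 ^ 2 * X 0) + C (ω ^ 2) * (X 2 ^ 2 * X 1) : MvPolynomial (Fin 3) _)
local notation3 "𝐁₄[" ω "]" =>
  (X 0 ^ 2 * X 1 + C ω * (X 1 ^ 2 * X 2) + C (ω ^ 2) * (X 2 ^ 2 * X 0) : MvPolynomial (Fin 3) _)
local notation3 "𝐁₈[" ω "]" =>
  (X 0 ^ 2 * X 2 + C (ω ^ 2) * (X 1 ^ 2 * X 0) + C ω * (X 2 ^ 2 * X 1) : MvPolynomial (Fin 3) _)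

section OrderNine

variable {K : Type u} [Field K] {μ : K} (vec : (𝐖[μ] : WeierstrassCurve K).toAffine.Point → Fin 3 → K)

/-! ## §1 The tangent at `P` passes through the translate `P + T` iff `3P + T = O` -/

/-- **The group-theoretic heart of Prop. 5.2**: let `T ≠ O` and let `τ` realise the translation
by `T` on Hesse points (`N vec (P + T) ∥ τ(N vec P)` for every `P`).  Then the tangent to `H_μ`
at the point of `P` passes through the point of `P + T` — `⟨∇H_μ(N vec P), τ(N vec P)⟩ = 0` — if
and only if `3P + T = O` ("`2p ⊕ q = 0`" with `q = p ⊕ t`: g20-#1 transported by g20-#3).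
[cite: ArtebaniDolgachev2009, §5 (proof of Prop. 5.2)] -/
theorem hesse_tangent_contains_translate_iff [DecidableEq K] (h3 : (3 : K) ≠ 0) (hμ : μ ^ 3 ≠ 1)
    (hv0 : vec 0 = ![0, 1, 0])
    (hvs : ∀ x y (h : (𝐖[μ] : WeierstrassCurve K).toAffine.Nonsingular x y), vec (.some x y h) = ![x, y, 1])
    {T : (𝐖[μ] : WeierstrassCurve K).toAffine.Point} (hT : T ≠ 0) {τ : (Fin 3 → K) → Fin 3 → K}
    (hτ : ∀ P : (𝐖[μ] : WeierstrassCurve K).toAffine.Point, ∃ c : K, c ≠ 0 ∧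
      τ ((𝐍[μ] : Matrix (Fin 3) (Fin 3) K) *ᵥ vec P) = c • ((𝐍[μ] : Matrix (Fin 3) (Fin 3) K) *ᵥ vec (P + T)))
    (P : (𝐖[μ] : WeierstrassCurve K).toAffine.Point) :
    (fun i => eval ((𝐍[μ] : Matrix (Fin 3) (Fin 3) K) *ᵥ vec P) (pderiv i 𝐇[μ])) ⬝ᵥ
        τ ((𝐍[μ] : Matrix (Fin 3) (Fin 3) K) *ᵥ vec P) = 0 ↔ 3 • P + T = 0 := by
  obtain ⟨c, hc, h⟩ := hτ P
  rw [h, dotProduct_smul, smul_eq_zero, or_iff_right hc, hesse_grad_N_dotProduct h3, mul_eq_zero,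
    or_iff_right (sub_ne_zero.2 hμ), weierstrass_grad_dotProduct_eq_zero_iff _ vec hv0 hvs]
  constructor
  · rintro (h' | h')
    · exact absurd (add_eq_left.1 h') hT
    · rwa [← add_assoc, ← succ_nsmul] at h'
  · intro h'
    right
    rwa [← add_assoc, ← succ_nsmul]

/-! ## §2 The eight translations `g₂^a t₃^b` and their points `aT₁ + bT₃` -/

/-- Composition of translations on Hesse points: if `τ₁` realises `+S₁` and `τ₂` realises `+S₂`
(each linear in the sense `τ₂ (c·v) = c·τ₂ v`), then `τ₂ ∘ τ₁` realises `+(S₁ + S₂)`.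
[cite: ArtebaniDolgachev2009, §4 (`Γ = ⟨g₁, g₂⟩ ≅ (ℤ/3ℤ)²` acts by translations)] -/
theorem hesse_translation_comp
    {S₁ S₂ : (𝐖[μ] : WeierstrassCurve K).toAffine.Point} [DecidableEq K]
    {τ₁ : (Fin 3 → K) → Fin 3 → K} {M₂ : Matrix (Fin 3) (Fin 3) K}
    (h₁ : ∀ P : (𝐖[μ] : WeierstrassCurve K).toAffine.Point, ∃ c : K, c ≠ 0 ∧
      τ₁ ((𝐍[μ] : Matrix (Fin 3) (Fin 3) K) *ᵥ vec P) = c • ((𝐍[μ] : Matrix (Fin 3) (Fin 3) K) *ᵥ vec (P + S₁)))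
    (h₂ : ∀ P : (𝐖[μ] : WeierstrassCurve K).toAffine.Point, ∃ c : K, c ≠ 0 ∧
      M₂ *ᵥ ((𝐍[μ] : Matrix (Fin 3) (Fin 3) K) *ᵥ vec P) = c • ((𝐍[μ] : Matrix (Fin 3) (Fin 3) K) *ᵥ vec (P + S₂)))
    (P : (𝐖[μ] : WeierstrassCurve K).toAffine.Point) :
    ∃ c : K, c ≠ 0 ∧ M₂ *ᵥ (τ₁ ((𝐍[μ] : Matrix (Fin 3) (Fin 3) K) *ᵥ vec P)) =
      c • ((𝐍[μ] : Matrix (Fin 3) (Fin 3) K) *ᵥ vec (P + (S₁ + S₂))) := by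
  obtain ⟨c, hc, hc'⟩ := h₁ P
  obtain ⟨d, hd, hd'⟩ := h₂ (P + S₁)
  refine ⟨c * d, mul_ne_zero hc hd, ?_⟩
  rw [hc', Matrix.mulVec_smul, hd', smul_smul, add_assoc]

variable {ω : K} {T₁ T₃ : (𝐖[μ] : WeierstrassCurve K).toAffine.Point} {c₁ c₃ : K}

/-- The two generators as translation data: `g₂` realises `+T₁`, `t₃` realises `+T₃` (g20-#3).
[cite: ArtebaniDolgachev2009, §4 ("`g₁` induces the translation by the 3-torsion point `p₃` and
`g₂` that by the point `p₁`")] -/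
theorem hesse_translation_data [DecidableEq K] (h3 : (3 : K) ≠ 0) (hμ : μ ^ 3 ≠ 1)
    (hω : ω ^ 2 + ω + 1 = 0) (hv0 : vec 0 = ![0, 1, 0])
    (hvs : ∀ x y (h : (𝐖[μ] : WeierstrassCurve K).toAffine.Nonsingular x y), vec (.some x y h) = ![x, y, 1])
    (hc₁ : c₁ ≠ 0) (hT₁ : (𝐍[μ] : Matrix (Fin 3) (Fin 3) K) *ᵥ vec T₁ = c₁ • ![(0 : K), 1, -ω])
    (hc₃ : c₃ ≠ 0) (hT₃ : (𝐍[μ] : Matrix (Fin 3) (Fin 3) K) *ᵥ vec T₃ = c₃ • ![(1 : K), 0, -1]) :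
    (∀ P : (𝐖[μ] : WeierstrassCurve K).toAffine.Point, ∃ c : K, c ≠ 0 ∧
      (𝐠₂[ω] : Matrix (Fin 3) (Fin 3) K) *ᵥ ((𝐍[μ] : Matrix (Fin 3) (Fin 3) K) *ᵥ vec P) =
        c • ((𝐍[μ] : Matrix (Fin 3) (Fin 3) K) *ᵥ vec (P + T₁))) ∧
    (∀ P : (𝐖[μ] : WeierstrassCurve K).toAffine.Point, ∃ c : K, c ≠ 0 ∧
      (𝐭₃ : Matrix (Fin 3) (Fin 3) K) *ᵥ ((𝐍[μ] : Matrix (Fin 3) (Fin 3) K) *ᵥ vec P) =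
        c • ((𝐍[μ] : Matrix (Fin 3) (Fin 3) K) *ᵥ vec (P + T₃))) :=
  ⟨fun P => (hesse_translation_g₂_iff vec h3 hμ hω hv0 hvs hc₁ hT₁ P (P + T₁)).2 rfl,
    fun P => (hesse_translation_t₃_iff vec h3 hμ hv0 hvs hc₃ hT₃ P (P + T₃)).2 rfl⟩

/-- **The non-zero `3`-torsion points `aT₁ + bT₃` are non-zero** (`(a, b) ≠ (0, 0)`): their Hesse
points are the base points `p₁, …, p₈` (g20-#3 `hesse_basePoints_eq_torsion`), none of which is
`p₀` (`ω ≠ 1` as `3 ≠ 0`). [cite: ArtebaniDolgachev2009, §2 (the nine base points and the table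
(matrix2))] -/
theorem hesse_torsion_ne_zero [DecidableEq K] (h3 : (3 : K) ≠ 0) (hμ : μ ^ 3 ≠ 1)
    (hω : ω ^ 2 + ω + 1 = 0) (hv0 : vec 0 = ![0, 1, 0])
    (hvs : ∀ x y (h : (𝐖[μ] : WeierstrassCurve K).toAffine.Nonsingular x y), vec (.some x y h) = ![x, y, 1])
    (hc₁ : c₁ ≠ 0) (hT₁ : (𝐍[μ] : Matrix (Fin 3) (Fin 3) K) *ᵥ vec T₁ = c₁ • ![(0 : K), 1, -ω])
    (hc₃ : c₃ ≠ 0) (hT₃ : (𝐍[μ] : Matrix (Fin 3) (Fin 3) K) *ᵥ vec T₃ = c₃ • ![(1 : K), 0, -1]) :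
    T₁ ≠ 0 ∧ 2 • T₁ ≠ 0 ∧ T₃ ≠ 0 ∧ T₁ + T₃ ≠ 0 ∧ 2 • T₁ + T₃ ≠ 0 ∧ 2 • T₃ ≠ 0 ∧
      T₁ + 2 • T₃ ≠ 0 ∧ 2 • T₁ + 2 • T₃ ≠ 0 := by
  have h3ω : ω ^ 3 = 1 := by linear_combination (ω - 1) * hω
  -- `ω ≠ 1` and `ω² ≠ 1` since `3 ≠ 0`
  have hω1 : ω ≠ 1 := by
    rintro rfl; apply h3; linear_combination hω
  have hω2 : ω ^ 2 ≠ 1 := by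
    intro h; apply h3
    linear_combination (2 - ω) * hω + (ω - 1) * h
  obtain ⟨hN0, h2, h4, h5, h6, h7, h8⟩ :=
    hesse_basePoints_eq_torsion vec h3 hμ hω hv0 hvs hc₁ hT₁ hc₃ hT₃
  -- a point `X` with `N vec X = c • q`, `q ∦ p₀`, is not `O`
  have key : ∀ {X : (𝐖[μ] : WeierstrassCurve K).toAffine.Point} {q : Fin 3 → K},
      (∃ c : K, c ≠ 0 ∧ (𝐍[μ] : Matrix (Fin 3) (Fin 3) K) *ᵥ vec X = c • q) →
      (∀ c : K, c • q ≠ ![(0 : K), 1, -1]) → X ≠ 0 := by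
    rintro X q ⟨c, hc, hX⟩ hq rfl
    exact hq c (by rw [← hX, hN0])
  have nq1 : ∀ k : ℕ, ω ^ k ≠ 1 → ∀ c : K, c • (![(0 : K), 1, -ω ^ k] : Fin 3 → K) ≠ ![(0 : K), 1, -1] := by
    intro k hk c h
    have e1 : c = 1 := by simpa using congrFun h 1
    have e2 : c * -ω ^ k = -1 := by simpa using congrFun h 2
    rw [e1, one_mul, neg_inj] at e2
    exact hk e2
  have nq2 : ∀ (a b c : K), c • (![(1 : K), a, b] : Fin 3 → K) ≠ ![(0 : K), 1, -1] := by
    intro a b c h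
    have e0 : c = 0 := by simpa using congrFun h 0
    have e1 : c * a = 1 := by simpa using congrFun h 1
    rw [e0, zero_mul] at e1
    exact zero_ne_one e1
  refine ⟨key ⟨c₁, hc₁, hT₁⟩ (by simpa using nq1 1 (by rwa [pow_one])), key h2 (nq1 2 hω2),
    key ⟨c₃, hc₃, hT₃⟩ (nq2 _ _), key h4 (nq2 _ _), key h5 (nq2 _ _), key h6 (nq2 _ _),
    key h7 (nq2 _ _), key h8 (nq2 _ _)⟩

/-! ## §3 Prop. 5.2, first assertion, cubic by cubic -/

/-- The eight translations as data: `g₂^a t₃^b` realises `+(aT₁ + bT₃)` on Hesse points, composed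
from `g₂ = +T₁` and `t₃ = +T₃` (`hesse_translation_data`, `hesse_translation_comp`).
[cite: ArtebaniDolgachev2009, §4 (`Γ ≅ (ℤ/3ℤ)²` acts by translations)] -/
theorem hesse_translation_data₈ [DecidableEq K] (h3 : (3 : K) ≠ 0) (hμ : μ ^ 3 ≠ 1)
    (hω : ω ^ 2 + ω + 1 = 0) (hv0 : vec 0 = ![0, 1, 0])
    (hvs : ∀ x y (h : (𝐖[μ] : WeierstrassCurve K).toAffine.Nonsingular x y), vec (.some x y h) = ![x, y, 1])
    (hc₁ : c₁ ≠ 0) (hT₁ : (𝐍[μ] : Matrix (Fin 3) (Fin 3) K) *ᵥ vec T₁ = c₁ • ![(0 : K), 1, -ω])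
    (hc₃ : c₃ ≠ 0) (hT₃ : (𝐍[μ] : Matrix (Fin 3) (Fin 3) K) *ᵥ vec T₃ = c₃ • ![(1 : K), 0, -1])
    (P : (𝐖[μ] : WeierstrassCurve K).toAffine.Point) :
    (∃ c : K, c ≠ 0 ∧ (𝐠₂[ω] : Matrix (Fin 3) (Fin 3) K) *ᵥ ((𝐠₂[ω] : Matrix (Fin 3) (Fin 3) K) *ᵥ
        ((𝐍[μ] : Matrix (Fin 3) (Fin 3) K) *ᵥ vec P)) =
        c • ((𝐍[μ] : Matrix (Fin 3) (Fin 3) K) *ᵥ vec (P + 2 • T₁))) ∧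
    (∃ c : K, c ≠ 0 ∧ (𝐭₃ : Matrix (Fin 3) (Fin 3) K) *ᵥ ((𝐭₃ : Matrix (Fin 3) (Fin 3) K) *ᵥ
        ((𝐍[μ] : Matrix (Fin 3) (Fin 3) K) *ᵥ vec P)) =
        c • ((𝐍[μ] : Matrix (Fin 3) (Fin 3) K) *ᵥ vec (P + 2 • T₃))) ∧
    (∃ c : K, c ≠ 0 ∧ (𝐠₂[ω] : Matrix (Fin 3) (Fin 3) K) *ᵥ ((𝐭₃ : Matrix (Fin 3) (Fin 3) K) *ᵥ
        ((𝐍[μ] : Matrix (Fin 3) (Fin 3) K) *ᵥ vec P)) =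
        c • ((𝐍[μ] : Matrix (Fin 3) (Fin 3) K) *ᵥ vec (P + (T₁ + T₃)))) ∧
    (∃ c : K, c ≠ 0 ∧ (𝐠₂[ω] : Matrix (Fin 3) (Fin 3) K) *ᵥ ((𝐠₂[ω] : Matrix (Fin 3) (Fin 3) K) *ᵥ
        ((𝐭₃ : Matrix (Fin 3) (Fin 3) K) *ᵥ ((𝐍[μ] : Matrix (Fin 3) (Fin 3) K) *ᵥ vec P))) =
        c • ((𝐍[μ] : Matrix (Fin 3) (Fin 3) K) *ᵥ vec (P + (2 • T₁ + T₃)))) ∧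
    (∃ c : K, c ≠ 0 ∧ (𝐠₂[ω] : Matrix (Fin 3) (Fin 3) K) *ᵥ ((𝐭₃ : Matrix (Fin 3) (Fin 3) K) *ᵥ
        ((𝐭₃ : Matrix (Fin 3) (Fin 3) K) *ᵥ ((𝐍[μ] : Matrix (Fin 3) (Fin 3) K) *ᵥ vec P))) =
        c • ((𝐍[μ] : Matrix (Fin 3) (Fin 3) K) *ᵥ vec (P + (T₁ + 2 • T₃)))) ∧
    (∃ c : K, c ≠ 0 ∧ (𝐠₂[ω] : Matrix (Fin 3) (Fin 3) K) *ᵥ ((𝐠₂[ω] : Matrix (Fin 3) (Fin 3) K) *ᵥ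
        ((𝐭₃ : Matrix (Fin 3) (Fin 3) K) *ᵥ ((𝐭₃ : Matrix (Fin 3) (Fin 3) K) *ᵥ
          ((𝐍[μ] : Matrix (Fin 3) (Fin 3) K) *ᵥ vec P)))) =
        c • ((𝐍[μ] : Matrix (Fin 3) (Fin 3) K) *ᵥ vec (P + (2 • T₁ + 2 • T₃)))) := by
  obtain ⟨tg, tt⟩ := hesse_translation_data vec h3 hμ hω hv0 hvs hc₁ hT₁ hc₃ hT₃
  have c20 := fun P => hesse_translation_comp vec tg tg P
  have c02 := fun P => hesse_translation_comp vec tt tt P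
  have c11 := fun P => hesse_translation_comp vec tt tg P
  have c21 := fun P => hesse_translation_comp vec (S₁ := T₃ + T₁)
    (τ₁ := fun v => (𝐠₂[ω] : Matrix (Fin 3) (Fin 3) K) *ᵥ ((𝐭₃ : Matrix (Fin 3) (Fin 3) K) *ᵥ v))
    c11 tg P
  have c12 := fun P => hesse_translation_comp vec (S₁ := T₃ + T₃)
    (τ₁ := fun v => (𝐭₃ : Matrix (Fin 3) (Fin 3) K) *ᵥ ((𝐭₃ : Matrix (Fin 3) (Fin 3) K) *ᵥ v))
    c02 tg P
  have c22 := fun P => hesse_translation_comp vec (S₁ := T₃ + T₃ + T₁)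
    (τ₁ := fun v => (𝐠₂[ω] : Matrix (Fin 3) (Fin 3) K) *ᵥ ((𝐭₃ : Matrix (Fin 3) (Fin 3) K) *ᵥ
      ((𝐭₃ : Matrix (Fin 3) (Fin 3) K) *ᵥ v)))
    c12 tg P
  have e20 : T₁ + T₁ = 2 • T₁ := (two_nsmul T₁).symm
  have e02 : T₃ + T₃ = 2 • T₃ := (two_nsmul T₃).symm
  have e11 : T₃ + T₁ = T₁ + T₃ := add_comm _ _
  have e21 : T₃ + T₁ + T₁ = 2 • T₁ + T₃ := by rw [two_nsmul]; abel
  have e12 : T₃ + T₃ + T₁ = T₁ + 2 • T₃ := by rw [two_nsmul]; abel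
  have e22 : T₃ + T₃ + T₁ + T₁ = 2 • T₁ + 2 • T₃ := by rw [two_nsmul, two_nsmul]; abel
  refine ⟨?_, ?_, ?_, ?_, ?_, ?_⟩
  · simpa only [e20] using c20 P
  · simpa only [e02] using c02 P
  · simpa only [e11] using c11 P
  · simpa only [e21] using c21 P
  · simpa only [e12] using c12 P
  · simpa only [e22] using c22 P

/-- From a translation and a tangent identity to a cubic: if `τ` realises `+T` (`T ≠ O`) and
`⟨∇H_μ(p), τ p⟩ = c · B(p)` identically with `c ≠ 0`, then `B(N vec P) = 0 ↔ 3P + T = O`.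
[cite: ArtebaniDolgachev2009, §5 (proof of Prop. 5.2)] -/
theorem hesse_cubic_eq_zero_iff_of_translation [DecidableEq K] (h3 : (3 : K) ≠ 0) (hμ : μ ^ 3 ≠ 1)
    (hv0 : vec 0 = ![0, 1, 0])
    (hvs : ∀ x y (h : (𝐖[μ] : WeierstrassCurve K).toAffine.Nonsingular x y), vec (.some x y h) = ![x, y, 1])
    {T : (𝐖[μ] : WeierstrassCurve K).toAffine.Point} (hT : T ≠ 0) {τ : (Fin 3 → K) → Fin 3 → K}
    (hτ : ∀ P : (𝐖[μ] : WeierstrassCurve K).toAffine.Point, ∃ c : K, c ≠ 0 ∧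
      τ ((𝐍[μ] : Matrix (Fin 3) (Fin 3) K) *ᵥ vec P) = c • ((𝐍[μ] : Matrix (Fin 3) (Fin 3) K) *ᵥ vec (P + T)))
    {B : (Fin 3 → K) → K} {c : K} (hc : c ≠ 0)
    (hB : ∀ p : Fin 3 → K, (fun i => eval p (pderiv i 𝐇[μ])) ⬝ᵥ τ p = c * B p)
    (P : (𝐖[μ] : WeierstrassCurve K).toAffine.Point) :
    B ((𝐍[μ] : Matrix (Fin 3) (Fin 3) K) *ᵥ vec P) = 0 ↔ 3 • P + T = 0 := by
  rw [← hesse_tangent_contains_translate_iff vec h3 hμ hv0 hvs hT hτ P, hB, mul_eq_zero,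
    or_iff_right hc]

/-- **`B₁ ∩ H_μ` = the coset `3P = −T₁`**: for `P ∈ W_μ(K)` with Hesse point `p = N vec P`, `B₁(p) = 0 ↔ 3P + T₁ = O` — the printed case: `q = g₂ p = (x₀, εy₀, ε²z₀)` is the point of `P + T₁` and lies on the tangent at `p` iff `B₁(p) = 0`. [cite: ArtebaniDolgachev2009, §5 (Prop. 5.2 and its proof)] -/
theorem hesse_B₁_eq_zero_iff [DecidableEq K] (h3 : (3 : K) ≠ 0) (hμ : μ ^ 3 ≠ 1)
    (hω : ω ^ 2 + ω + 1 = 0) (hv0 : vec 0 = ![0, 1, 0])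
    (hvs : ∀ x y (h : (𝐖[μ] : WeierstrassCurve K).toAffine.Nonsingular x y), vec (.some x y h) = ![x, y, 1])
    (hc₁ : c₁ ≠ 0) (hT₁ : (𝐍[μ] : Matrix (Fin 3) (Fin 3) K) *ᵥ vec T₁ = c₁ • ![(0 : K), 1, -ω])
    (hc₃ : c₃ ≠ 0) (hT₃ : (𝐍[μ] : Matrix (Fin 3) (Fin 3) K) *ᵥ vec T₃ = c₃ • ![(1 : K), 0, -1])
    (P : (𝐖[μ] : WeierstrassCurve K).toAffine.Point) :
    eval ((𝐍[μ] : Matrix (Fin 3) (Fin 3) K) *ᵥ vec P) 𝐁₁[ω] = 0 ↔ 3 • P + T₁ = 0 := by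
  have n₁ := (hesse_torsion_ne_zero vec h3 hμ hω hv0 hvs hc₁ hT₁ hc₃ hT₃).1
  obtain ⟨tg, -⟩ := hesse_translation_data vec h3 hμ hω hv0 hvs hc₁ hT₁ hc₃ hT₃
  refine hesse_cubic_eq_zero_iff_of_translation vec h3 hμ hv0 hvs n₁ (τ := fun v => (𝐠₂[ω] : Matrix (Fin 3) (Fin 3) K) *ᵥ v) tg
    (B := fun p => eval p 𝐁₁[ω]) (c := 3) h3 (fun p => ?_) P
  rw [mulVec_g₂, (hesse_grad_dotProduct_translations μ hω p).1]
  simp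

/-- **`B₅ ∩ H_μ` = the coset `3P = −2T₁`** (translation `g₂²`). [cite: ArtebaniDolgachev2009, §5 (Prop. 5.2 and its proof)] -/
theorem hesse_B₅_eq_zero_iff [DecidableEq K] (h3 : (3 : K) ≠ 0) (hμ : μ ^ 3 ≠ 1)
    (hω : ω ^ 2 + ω + 1 = 0) (hv0 : vec 0 = ![0, 1, 0])
    (hvs : ∀ x y (h : (𝐖[μ] : WeierstrassCurve K).toAffine.Nonsingular x y), vec (.some x y h) = ![x, y, 1])
    (hc₁ : c₁ ≠ 0) (hT₁ : (𝐍[μ] : Matrix (Fin 3) (Fin 3) K) *ᵥ vec T₁ = c₁ • ![(0 : K), 1, -ω])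
    (hc₃ : c₃ ≠ 0) (hT₃ : (𝐍[μ] : Matrix (Fin 3) (Fin 3) K) *ᵥ vec T₃ = c₃ • ![(1 : K), 0, -1])
    (P : (𝐖[μ] : WeierstrassCurve K).toAffine.Point) :
    eval ((𝐍[μ] : Matrix (Fin 3) (Fin 3) K) *ᵥ vec P) 𝐁₅[ω] = 0 ↔ 3 • P + 2 • T₁ = 0 := by
  have n₂ := (hesse_torsion_ne_zero vec h3 hμ hω hv0 hvs hc₁ hT₁ hc₃ hT₃).2.1
  refine hesse_cubic_eq_zero_iff_of_translation vec h3 hμ hv0 hvs n₂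
    (τ := fun v => (𝐠₂[ω] : Matrix (Fin 3) (Fin 3) K) *ᵥ ((𝐠₂[ω] : Matrix (Fin 3) (Fin 3) K) *ᵥ v))
    (fun P => (hesse_translation_data₈ vec h3 hμ hω hv0 hvs hc₁ hT₁ hc₃ hT₃ P).1)
    (B := fun p => eval p 𝐁₅[ω]) (c := 3) h3 (fun p => ?_) P
  rw [(hesse_grad_g₂_dotProduct_g₂_sq μ hω p).2, (hesse_grad_dotProduct_translations μ hω p).2.1]
  simp

/-- **`B₆ ∩ H_μ` = the coset `3P = −T₃`** (translation `t₃ = g₁⁻¹`). [cite: ArtebaniDolgachev2009, §5 (Prop. 5.2 and its proof)] -/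
theorem hesse_B₆_eq_zero_iff [DecidableEq K] (h3 : (3 : K) ≠ 0) (hμ : μ ^ 3 ≠ 1)
    (hω : ω ^ 2 + ω + 1 = 0) (hv0 : vec 0 = ![0, 1, 0])
    (hvs : ∀ x y (h : (𝐖[μ] : WeierstrassCurve K).toAffine.Nonsingular x y), vec (.some x y h) = ![x, y, 1])
    (hc₁ : c₁ ≠ 0) (hT₁ : (𝐍[μ] : Matrix (Fin 3) (Fin 3) K) *ᵥ vec T₁ = c₁ • ![(0 : K), 1, -ω])
    (hc₃ : c₃ ≠ 0) (hT₃ : (𝐍[μ] : Matrix (Fin 3) (Fin 3) K) *ᵥ vec T₃ = c₃ • ![(1 : K), 0, -1])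
    (P : (𝐖[μ] : WeierstrassCurve K).toAffine.Point) :
    eval ((𝐍[μ] : Matrix (Fin 3) (Fin 3) K) *ᵥ vec P) (𝐁₆ : MvPolynomial (Fin 3) K) = 0 ↔ 3 • P + T₃ = 0 := by
  have h3ω : ω ^ 3 = 1 := by linear_combination (ω - 1) * hω
  have k₁ := (translation_constants_ne_zero hμ h3ω).1
  have n₃ := (hesse_torsion_ne_zero vec h3 hμ hω hv0 hvs hc₁ hT₁ hc₃ hT₃).2.2.1
  obtain ⟨-, tt⟩ := hesse_translation_data vec h3 hμ hω hv0 hvs hc₁ hT₁ hc₃ hT₃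
  refine hesse_cubic_eq_zero_iff_of_translation vec h3 hμ hv0 hvs n₃ (τ := fun v => (𝐭₃ : Matrix (Fin 3) (Fin 3) K) *ᵥ v) tt
    (B := fun p => eval p (𝐁₆ : MvPolynomial (Fin 3) K)) (c := 3 * (1 - μ)) (mul_ne_zero h3 k₁)
    (fun p => ?_) P
  rw [mulVec_t₃, (hesse_grad_dotProduct_translations μ hω p).2.2.1]
  simp

/-- **`B₂ ∩ H_μ` = the coset `3P = −2T₃`** (translation `t₃²`). [cite: ArtebaniDolgachev2009, §5 (Prop. 5.2 and its proof)] -/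
theorem hesse_B₂_eq_zero_iff [DecidableEq K] (h3 : (3 : K) ≠ 0) (hμ : μ ^ 3 ≠ 1)
    (hω : ω ^ 2 + ω + 1 = 0) (hv0 : vec 0 = ![0, 1, 0])
    (hvs : ∀ x y (h : (𝐖[μ] : WeierstrassCurve K).toAffine.Nonsingular x y), vec (.some x y h) = ![x, y, 1])
    (hc₁ : c₁ ≠ 0) (hT₁ : (𝐍[μ] : Matrix (Fin 3) (Fin 3) K) *ᵥ vec T₁ = c₁ • ![(0 : K), 1, -ω])
    (hc₃ : c₃ ≠ 0) (hT₃ : (𝐍[μ] : Matrix (Fin 3) (Fin 3) K) *ᵥ vec T₃ = c₃ • ![(1 : K), 0, -1])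
    (P : (𝐖[μ] : WeierstrassCurve K).toAffine.Point) :
    eval ((𝐍[μ] : Matrix (Fin 3) (Fin 3) K) *ᵥ vec P) (𝐁₂ : MvPolynomial (Fin 3) K) = 0 ↔ 3 • P + 2 • T₃ = 0 := by
  have h3ω : ω ^ 3 = 1 := by linear_combination (ω - 1) * hω
  have k₁ := (translation_constants_ne_zero hμ h3ω).1
  have n₆ := (hesse_torsion_ne_zero vec h3 hμ hω hv0 hvs hc₁ hT₁ hc₃ hT₃).2.2.2.2.2.1
  refine hesse_cubic_eq_zero_iff_of_translation vec h3 hμ hv0 hvs n₆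
    (τ := fun v => (𝐭₃ : Matrix (Fin 3) (Fin 3) K) *ᵥ ((𝐭₃ : Matrix (Fin 3) (Fin 3) K) *ᵥ v))
    (fun P => (hesse_translation_data₈ vec h3 hμ hω hv0 hvs hc₁ hT₁ hc₃ hT₃ P).2.1)
    (B := fun p => eval p (𝐁₂ : MvPolynomial (Fin 3) K)) (c := 3 * (1 - μ)) (mul_ne_zero h3 k₁)
    (fun p => ?_) P
  have e : (𝐭₃ : Matrix (Fin 3) (Fin 3) K) *ᵥ ((𝐭₃ : Matrix (Fin 3) (Fin 3) K) *ᵥ p) = ![p 1, p 2, p 0] := by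
    rw [mulVec_t₃, mulVec_t₃]; funext i; fin_cases i <;> simp
  rw [e, (hesse_grad_dotProduct_translations μ hω p).2.2.2.1]
  simp

/-- **`B₇ ∩ H_μ` = the coset `3P = −(T₁ + T₃)`** (translation `g₂ t₃`). [cite: ArtebaniDolgachev2009, §5 (Prop. 5.2 and its proof)] -/
theorem hesse_B₇_eq_zero_iff [DecidableEq K] (h3 : (3 : K) ≠ 0) (hμ : μ ^ 3 ≠ 1)
    (hω : ω ^ 2 + ω + 1 = 0) (hv0 : vec 0 = ![0, 1, 0])
    (hvs : ∀ x y (h : (𝐖[μ] : WeierstrassCurve K).toAffine.Nonsingular x y), vec (.some x y h) = ![x, y, 1])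
    (hc₁ : c₁ ≠ 0) (hT₁ : (𝐍[μ] : Matrix (Fin 3) (Fin 3) K) *ᵥ vec T₁ = c₁ • ![(0 : K), 1, -ω])
    (hc₃ : c₃ ≠ 0) (hT₃ : (𝐍[μ] : Matrix (Fin 3) (Fin 3) K) *ᵥ vec T₃ = c₃ • ![(1 : K), 0, -1])
    (P : (𝐖[μ] : WeierstrassCurve K).toAffine.Point) :
    eval ((𝐍[μ] : Matrix (Fin 3) (Fin 3) K) *ᵥ vec P) 𝐁₇[ω] = 0 ↔ 3 • P + (T₁ + T₃) = 0 := by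
  have h3ω : ω ^ 3 = 1 := by linear_combination (ω - 1) * hω
  have k₂ := (translation_constants_ne_zero hμ h3ω).2.1
  have n₄ := (hesse_torsion_ne_zero vec h3 hμ hω hv0 hvs hc₁ hT₁ hc₃ hT₃).2.2.2.1
  refine hesse_cubic_eq_zero_iff_of_translation vec h3 hμ hv0 hvs n₄
    (τ := fun v => (𝐠₂[ω] : Matrix (Fin 3) (Fin 3) K) *ᵥ ((𝐭₃ : Matrix (Fin 3) (Fin 3) K) *ᵥ v))
    (fun P => (hesse_translation_data₈ vec h3 hμ hω hv0 hvs hc₁ hT₁ hc₃ hT₃ P).2.2.1)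
    (B := fun p => eval p 𝐁₇[ω]) (c := 3 * (1 - ω * μ)) (mul_ne_zero h3 k₂) (fun p => ?_) P
  have e : (𝐠₂[ω] : Matrix (Fin 3) (Fin 3) K) *ᵥ ((𝐭₃ : Matrix (Fin 3) (Fin 3) K) *ᵥ p) = ![p 2, ω * p 0, ω ^ 2 * p 1] := by
    rw [mulVec_t₃, mulVec_g₂]; funext i; fin_cases i <;> simp
  have hev : eval p 𝐁₇[ω] = p 0 ^ 2 * p 2 + ω * p 1 ^ 2 * p 0 + ω ^ 2 * p 2 ^ 2 * p 1 := by
    simp; ring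
  rw [e, (hesse_grad_dotProduct_translations μ hω p).2.2.2.2.1, hev]

/-- **`B₈ ∩ H_μ` = the coset `3P = −(2T₁ + T₃)`** (translation `g₂² t₃`). [cite: ArtebaniDolgachev2009, §5 (Prop. 5.2 and its proof)] -/
theorem hesse_B₈_eq_zero_iff [DecidableEq K] (h3 : (3 : K) ≠ 0) (hμ : μ ^ 3 ≠ 1)
    (hω : ω ^ 2 + ω + 1 = 0) (hv0 : vec 0 = ![0, 1, 0])
    (hvs : ∀ x y (h : (𝐖[μ] : WeierstrassCurve K).toAffine.Nonsingular x y), vec (.some x y h) = ![x, y, 1])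
    (hc₁ : c₁ ≠ 0) (hT₁ : (𝐍[μ] : Matrix (Fin 3) (Fin 3) K) *ᵥ vec T₁ = c₁ • ![(0 : K), 1, -ω])
    (hc₃ : c₃ ≠ 0) (hT₃ : (𝐍[μ] : Matrix (Fin 3) (Fin 3) K) *ᵥ vec T₃ = c₃ • ![(1 : K), 0, -1])
    (P : (𝐖[μ] : WeierstrassCurve K).toAffine.Point) :
    eval ((𝐍[μ] : Matrix (Fin 3) (Fin 3) K) *ᵥ vec P) 𝐁₈[ω] = 0 ↔ 3 • P + (2 • T₁ + T₃) = 0 := by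
  have h3ω : ω ^ 3 = 1 := by linear_combination (ω - 1) * hω
  have k₃ := (translation_constants_ne_zero hμ h3ω).2.2
  have n₅ := (hesse_torsion_ne_zero vec h3 hμ hω hv0 hvs hc₁ hT₁ hc₃ hT₃).2.2.2.2.1
  have h4 : ω ^ 4 = ω := by rw [show ω ^ 4 = ω ^ 3 * ω by ring, h3ω, one_mul]
  refine hesse_cubic_eq_zero_iff_of_translation vec h3 hμ hv0 hvs n₅
    (τ := fun v => (𝐠₂[ω] : Matrix (Fin 3) (Fin 3) K) *ᵥ ((𝐠₂[ω] : Matrix (Fin 3) (Fin 3) K) *ᵥ ((𝐭₃ : Matrix (Fin 3) (Fin 3) K) *ᵥ v)))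
    (fun P => (hesse_translation_data₈ vec h3 hμ hω hv0 hvs hc₁ hT₁ hc₃ hT₃ P).2.2.2.1)
    (B := fun p => eval p 𝐁₈[ω]) (c := 3 * (1 - ω ^ 2 * μ)) (mul_ne_zero h3 k₃) (fun p => ?_) P
  have e : (𝐠₂[ω] : Matrix (Fin 3) (Fin 3) K) *ᵥ ((𝐠₂[ω] : Matrix (Fin 3) (Fin 3) K) *ᵥ ((𝐭₃ : Matrix (Fin 3) (Fin 3) K) *ᵥ p)) = ![p 2, ω ^ 2 * p 0, ω * p 1] := by
    rw [mulVec_t₃, mulVec_g₂, mulVec_g₂]; funext i; fin_cases i <;> simp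
    · ring
    · linear_combination p 1 * h4
  have hev : eval p 𝐁₈[ω] = p 0 ^ 2 * p 2 + ω ^ 2 * p 1 ^ 2 * p 0 + ω * p 2 ^ 2 * p 1 := by
    simp; ring
  rw [e, (hesse_grad_dotProduct_translations μ hω p).2.2.2.2.2.1, hev]

/-- **`B₄ ∩ H_μ` = the coset `3P = −(T₁ + 2T₃)`** (translation `g₂ t₃²`). [cite: ArtebaniDolgachev2009, §5 (Prop. 5.2 and its proof)] -/
theorem hesse_B₄_eq_zero_iff [DecidableEq K] (h3 : (3 : K) ≠ 0) (hμ : μ ^ 3 ≠ 1)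
    (hω : ω ^ 2 + ω + 1 = 0) (hv0 : vec 0 = ![0, 1, 0])
    (hvs : ∀ x y (h : (𝐖[μ] : WeierstrassCurve K).toAffine.Nonsingular x y), vec (.some x y h) = ![x, y, 1])
    (hc₁ : c₁ ≠ 0) (hT₁ : (𝐍[μ] : Matrix (Fin 3) (Fin 3) K) *ᵥ vec T₁ = c₁ • ![(0 : K), 1, -ω])
    (hc₃ : c₃ ≠ 0) (hT₃ : (𝐍[μ] : Matrix (Fin 3) (Fin 3) K) *ᵥ vec T₃ = c₃ • ![(1 : K), 0, -1])
    (P : (𝐖[μ] : WeierstrassCurve K).toAffine.Point) :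
    eval ((𝐍[μ] : Matrix (Fin 3) (Fin 3) K) *ᵥ vec P) 𝐁₄[ω] = 0 ↔ 3 • P + (T₁ + 2 • T₃) = 0 := by
  have h3ω : ω ^ 3 = 1 := by linear_combination (ω - 1) * hω
  have k₃ := (translation_constants_ne_zero hμ h3ω).2.2
  have n₇ := (hesse_torsion_ne_zero vec h3 hμ hω hv0 hvs hc₁ hT₁ hc₃ hT₃).2.2.2.2.2.2.1
  refine hesse_cubic_eq_zero_iff_of_translation vec h3 hμ hv0 hvs n₇
    (τ := fun v => (𝐠₂[ω] : Matrix (Fin 3) (Fin 3) K) *ᵥ ((𝐭₃ : Matrix (Fin 3) (Fin 3) K) *ᵥ ((𝐭₃ : Matrix (Fin 3) (Fin 3) K) *ᵥ v)))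
    (fun P => (hesse_translation_data₈ vec h3 hμ hω hv0 hvs hc₁ hT₁ hc₃ hT₃ P).2.2.2.2.1)
    (B := fun p => eval p 𝐁₄[ω]) (c := 3 * (1 - ω ^ 2 * μ)) (mul_ne_zero h3 k₃) (fun p => ?_) P
  have e : (𝐠₂[ω] : Matrix (Fin 3) (Fin 3) K) *ᵥ ((𝐭₃ : Matrix (Fin 3) (Fin 3) K) *ᵥ ((𝐭₃ : Matrix (Fin 3) (Fin 3) K) *ᵥ p)) = ![p 1, ω * p 2, ω ^ 2 * p 0] := by
    rw [mulVec_t₃, mulVec_t₃, mulVec_g₂]; funext i; fin_cases i <;> simp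
  have hev : eval p 𝐁₄[ω] = p 0 ^ 2 * p 1 + ω * p 1 ^ 2 * p 2 + ω ^ 2 * p 2 ^ 2 * p 0 := by
    simp; ring
  rw [e, (hesse_grad_dotProduct_translations μ hω p).2.2.2.2.2.2.1, hev]

/-- **`B₃ ∩ H_μ` = the coset `3P = −(2T₁ + 2T₃)`** (translation `g₂² t₃²`). [cite: ArtebaniDolgachev2009, §5 (Prop. 5.2 and its proof)] -/
theorem hesse_B₃_eq_zero_iff [DecidableEq K] (h3 : (3 : K) ≠ 0) (hμ : μ ^ 3 ≠ 1)
    (hω : ω ^ 2 + ω + 1 = 0) (hv0 : vec 0 = ![0, 1, 0])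
    (hvs : ∀ x y (h : (𝐖[μ] : WeierstrassCurve K).toAffine.Nonsingular x y), vec (.some x y h) = ![x, y, 1])
    (hc₁ : c₁ ≠ 0) (hT₁ : (𝐍[μ] : Matrix (Fin 3) (Fin 3) K) *ᵥ vec T₁ = c₁ • ![(0 : K), 1, -ω])
    (hc₃ : c₃ ≠ 0) (hT₃ : (𝐍[μ] : Matrix (Fin 3) (Fin 3) K) *ᵥ vec T₃ = c₃ • ![(1 : K), 0, -1])
    (P : (𝐖[μ] : WeierstrassCurve K).toAffine.Point) :
    eval ((𝐍[μ] : Matrix (Fin 3) (Fin 3) K) *ᵥ vec P) 𝐁₃[ω] = 0 ↔ 3 • P + (2 • T₁ + 2 • T₃) = 0 := by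
  have h3ω : ω ^ 3 = 1 := by linear_combination (ω - 1) * hω
  have k₂ := (translation_constants_ne_zero hμ h3ω).2.1
  have n₈ := (hesse_torsion_ne_zero vec h3 hμ hω hv0 hvs hc₁ hT₁ hc₃ hT₃).2.2.2.2.2.2.2
  have h4 : ω ^ 4 = ω := by rw [show ω ^ 4 = ω ^ 3 * ω by ring, h3ω, one_mul]
  refine hesse_cubic_eq_zero_iff_of_translation vec h3 hμ hv0 hvs n₈
    (τ := fun v => (𝐠₂[ω] : Matrix (Fin 3) (Fin 3) K) *ᵥ ((𝐠₂[ω] : Matrix (Fin 3) (Fin 3) K) *ᵥ ((𝐭₃ : Matrix (Fin 3) (Fin 3) K) *ᵥ ((𝐭₃ : Matrix (Fin 3) (Fin 3) K) *ᵥ v))))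
    (fun P => (hesse_translation_data₈ vec h3 hμ hω hv0 hvs hc₁ hT₁ hc₃ hT₃ P).2.2.2.2.2)
    (B := fun p => eval p 𝐁₃[ω]) (c := 3 * (1 - ω * μ)) (mul_ne_zero h3 k₂) (fun p => ?_) P
  have e : (𝐠₂[ω] : Matrix (Fin 3) (Fin 3) K) *ᵥ ((𝐠₂[ω] : Matrix (Fin 3) (Fin 3) K) *ᵥ ((𝐭₃ : Matrix (Fin 3) (Fin 3) K) *ᵥ ((𝐭₃ : Matrix (Fin 3) (Fin 3) K) *ᵥ p))) = ![p 1, ω ^ 2 * p 2, ω * p 0] := by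
    rw [mulVec_t₃, mulVec_t₃, mulVec_g₂, mulVec_g₂]; funext i; fin_cases i <;> simp
    · ring
    · linear_combination p 0 * h4
  have hev : eval p 𝐁₃[ω] = p 0 ^ 2 * p 1 + ω ^ 2 * p 1 ^ 2 * p 2 + ω * p 2 ^ 2 * p 0 := by
    simp; ring
  rw [e, (hesse_grad_dotProduct_translations μ hω p).2.2.2.2.2.2.2, hev]

/-- **Artebani–Dolgachev, Prop. 5.2 (first assertion), refined cubic by cubic: which coset of
`E[3]` each `Bᵢ` cuts out** (the eight statements above in one): for `P ∈ W_μ(K)` with Hesse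
point `p = N vec P` (zero `p₀`, `T₁, T₃` the points over `p₁ = (0,1,−ε)`, `p₃ = (1,0,−1)`):
`B₁(p) = 0 ↔ 3P + T₁ = O`, `B₅(p) = 0 ↔ 3P + 2T₁ = O`, `B₆(p) = 0 ↔ 3P + T₃ = O`,
`B₂(p) = 0 ↔ 3P + 2T₃ = O`, `B₇(p) = 0 ↔ 3P + (T₁ + T₃) = O`, `B₈(p) = 0 ↔ 3P + (2T₁ + T₃) = O`,
`B₄(p) = 0 ↔ 3P + (T₁ + 2T₃) = O`, `B₃(p) = 0 ↔ 3P + (2T₁ + 2T₃) = O` — the printed argument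
"`q = (x₀, εy₀, ε²z₀)` … lies on the tangent line at `p` if `p` satisfies `B₁`" for all eight
translations `g₂^a t₃^b` (g20-#2 `hesse_grad_dotProduct_translations`), read in the group (§1).
[cite: ArtebaniDolgachev2009, §5 (Prop. 5.2 and its proof)] -/
theorem hesse_B_eq_zero_iff [DecidableEq K] (h3 : (3 : K) ≠ 0) (hμ : μ ^ 3 ≠ 1)
    (hω : ω ^ 2 + ω + 1 = 0) (hv0 : vec 0 = ![0, 1, 0])
    (hvs : ∀ x y (h : (𝐖[μ] : WeierstrassCurve K).toAffine.Nonsingular x y), vec (.some x y h) = ![x, y, 1])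
    (hc₁ : c₁ ≠ 0) (hT₁ : (𝐍[μ] : Matrix (Fin 3) (Fin 3) K) *ᵥ vec T₁ = c₁ • ![(0 : K), 1, -ω])
    (hc₃ : c₃ ≠ 0) (hT₃ : (𝐍[μ] : Matrix (Fin 3) (Fin 3) K) *ᵥ vec T₃ = c₃ • ![(1 : K), 0, -1])
    (P : (𝐖[μ] : WeierstrassCurve K).toAffine.Point) :
    (eval ((𝐍[μ] : Matrix (Fin 3) (Fin 3) K) *ᵥ vec P) 𝐁₁[ω] = 0 ↔ 3 • P + T₁ = 0) ∧
    (eval ((𝐍[μ] : Matrix (Fin 3) (Fin 3) K) *ᵥ vec P) 𝐁₅[ω] = 0 ↔ 3 • P + 2 • T₁ = 0) ∧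
    (eval ((𝐍[μ] : Matrix (Fin 3) (Fin 3) K) *ᵥ vec P) (𝐁₆ : MvPolynomial (Fin 3) K) = 0 ↔ 3 • P + T₃ = 0) ∧
    (eval ((𝐍[μ] : Matrix (Fin 3) (Fin 3) K) *ᵥ vec P) (𝐁₂ : MvPolynomial (Fin 3) K) = 0 ↔ 3 • P + 2 • T₃ = 0) ∧
    (eval ((𝐍[μ] : Matrix (Fin 3) (Fin 3) K) *ᵥ vec P) 𝐁₇[ω] = 0 ↔ 3 • P + (T₁ + T₃) = 0) ∧
    (eval ((𝐍[μ] : Matrix (Fin 3) (Fin 3) K) *ᵥ vec P) 𝐁₈[ω] = 0 ↔ 3 • P + (2 • T₁ + T₃) = 0) ∧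
    (eval ((𝐍[μ] : Matrix (Fin 3) (Fin 3) K) *ᵥ vec P) 𝐁₄[ω] = 0 ↔ 3 • P + (T₁ + 2 • T₃) = 0) ∧
    (eval ((𝐍[μ] : Matrix (Fin 3) (Fin 3) K) *ᵥ vec P) 𝐁₃[ω] = 0 ↔ 3 • P + (2 • T₁ + 2 • T₃) = 0) :=
  ⟨hesse_B₁_eq_zero_iff vec h3 hμ hω hv0 hvs hc₁ hT₁ hc₃ hT₃ P,
    hesse_B₅_eq_zero_iff vec h3 hμ hω hv0 hvs hc₁ hT₁ hc₃ hT₃ P,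
    hesse_B₆_eq_zero_iff vec h3 hμ hω hv0 hvs hc₁ hT₁ hc₃ hT₃ P,
    hesse_B₂_eq_zero_iff vec h3 hμ hω hv0 hvs hc₁ hT₁ hc₃ hT₃ P,
    hesse_B₇_eq_zero_iff vec h3 hμ hω hv0 hvs hc₁ hT₁ hc₃ hT₃ P,
    hesse_B₈_eq_zero_iff vec h3 hμ hω hv0 hvs hc₁ hT₁ hc₃ hT₃ P,
    hesse_B₄_eq_zero_iff vec h3 hμ hω hv0 hvs hc₁ hT₁ hc₃ hT₃ P,
    hesse_B₃_eq_zero_iff vec h3 hμ hω hv0 hvs hc₁ hT₁ hc₃ hT₃ P⟩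

/-! ## §4 "cuts out … the set of points of order `9`" -/

omit [Field K] in
/-- The order count: `3P + R = O` with `R ≠ O`, `3R = O` forces `P` to have order exactly `9`
(`9P = −3R = O`, `3P = −R ≠ O`). [cite: ArtebaniDolgachev2009, §5 (Prop. 5.2: "the set of points
of order `9`")] -/
theorem addOrderOf_eq_nine_of_three_nsmul_add {A : Type*} [AddCommGroup A] {P R : A}
    (h : 3 • P + R = 0) (hR0 : R ≠ 0) (hR3 : 3 • R = 0) : addOrderOf P = 9 := by
  have h3P : 3 • P = -R := eq_neg_of_add_eq_zero_left h
  have h9 : (3 ^ 2) • P = 0 := by rw [pow_two, mul_nsmul', h3P, smul_neg, hR3, neg_zero]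
  have hne : 3 • P ≠ 0 := by rw [h3P, neg_ne_zero]; exact hR0
  obtain ⟨k, hk, hk'⟩ := (Nat.dvd_prime_pow Nat.prime_three).1 (addOrderOf_dvd_of_nsmul_eq_zero h9)
  interval_cases k
  · exfalso; apply hne
    rw [pow_zero, AddMonoid.addOrderOf_eq_one_iff] at hk'
    rw [hk', smul_zero]
  · exfalso; apply hne
    rw [pow_one] at hk'
    rw [← hk']; exact addOrderOf_nsmul_eq_zero P
  · simpa using hk'

/-- **"The union of the eight cubics `Bᵢ` cuts out on each nonsingular member of the Hesse pencil
the set of points of order `9` in the group law with the point `p₀` as the origin"** — the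
inclusion proved here over any field (`3 ≠ 0`, `μ³ ≠ 1`, `ω² + ω + 1 = 0`): if the Hesse point
`p = N vec P` of `P ∈ W_μ(K)` lies on one of `B₁, …, B₈`, then `P` has order exactly `9` (by §3,
`3P = −(aT₁ + bT₃) ≠ O` and `9P = O`).  The reverse inclusion is the `←` direction of §3 for each
coset `3P ∈ −(aT₁ + bT₃)`, i.e. for every point of order `9` once `W_μ(K)[3] = {aT₁ + bT₃}`.
[cite: ArtebaniDolgachev2009, §5 (Prop. 5.2, first assertion)] -/
theorem hesse_addOrderOf_eq_nine [DecidableEq K] (h3 : (3 : K) ≠ 0) (hμ : μ ^ 3 ≠ 1)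
    (hω : ω ^ 2 + ω + 1 = 0) (hv0 : vec 0 = ![0, 1, 0])
    (hvs : ∀ x y (h : (𝐖[μ] : WeierstrassCurve K).toAffine.Nonsingular x y), vec (.some x y h) = ![x, y, 1])
    (hc₁ : c₁ ≠ 0) (hT₁ : (𝐍[μ] : Matrix (Fin 3) (Fin 3) K) *ᵥ vec T₁ = c₁ • ![(0 : K), 1, -ω])
    (hc₃ : c₃ ≠ 0) (hT₃ : (𝐍[μ] : Matrix (Fin 3) (Fin 3) K) *ᵥ vec T₃ = c₃ • ![(1 : K), 0, -1])
    (P : (𝐖[μ] : WeierstrassCurve K).toAffine.Point)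
    (hB : eval ((𝐍[μ] : Matrix (Fin 3) (Fin 3) K) *ᵥ vec P) 𝐁₁[ω] = 0 ∨
      eval ((𝐍[μ] : Matrix (Fin 3) (Fin 3) K) *ᵥ vec P) 𝐁₅[ω] = 0 ∨
      eval ((𝐍[μ] : Matrix (Fin 3) (Fin 3) K) *ᵥ vec P) (𝐁₆ : MvPolynomial (Fin 3) K) = 0 ∨
      eval ((𝐍[μ] : Matrix (Fin 3) (Fin 3) K) *ᵥ vec P) (𝐁₂ : MvPolynomial (Fin 3) K) = 0 ∨
      eval ((𝐍[μ] : Matrix (Fin 3) (Fin 3) K) *ᵥ vec P) 𝐁₇[ω] = 0 ∨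
      eval ((𝐍[μ] : Matrix (Fin 3) (Fin 3) K) *ᵥ vec P) 𝐁₈[ω] = 0 ∨
      eval ((𝐍[μ] : Matrix (Fin 3) (Fin 3) K) *ᵥ vec P) 𝐁₄[ω] = 0 ∨
      eval ((𝐍[μ] : Matrix (Fin 3) (Fin 3) K) *ᵥ vec P) 𝐁₃[ω] = 0) :
    addOrderOf P = 9 := by
  have h3ω : ω ^ 3 = 1 := by linear_combination (ω - 1) * hω
  obtain ⟨n₁, n₂, n₃, n₄, n₅, n₆, n₇, n₈⟩ := hesse_torsion_ne_zero vec h3 hμ hω hv0 hvs hc₁ hT₁ hc₃ hT₃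
  obtain ⟨b₁, b₅, b₆, b₂, b₇, b₈, b₄, b₃⟩ := hesse_B_eq_zero_iff vec h3 hμ hω hv0 hvs hc₁ hT₁ hc₃ hT₃ P
  have hR : ∀ a b : ℕ, 3 • (a • T₁ + b • T₃) = 0 :=
    three_nsmul_basePoints vec h3 hμ h3ω hv0 hvs hc₁ hT₁ hc₃ hT₃
  rcases hB with h | h | h | h | h | h | h | h
  · exact addOrderOf_eq_nine_of_three_nsmul_add (b₁.1 h) n₁ (by simpa using hR 1 0)
  · exact addOrderOf_eq_nine_of_three_nsmul_add (b₅.1 h) n₂ (by simpa using hR 2 0)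
  · exact addOrderOf_eq_nine_of_three_nsmul_add (b₆.1 h) n₃ (by simpa using hR 0 1)
  · exact addOrderOf_eq_nine_of_three_nsmul_add (b₂.1 h) n₆ (by simpa using hR 0 2)
  · exact addOrderOf_eq_nine_of_three_nsmul_add (b₇.1 h) n₄ (by simpa using hR 1 1)
  · exact addOrderOf_eq_nine_of_three_nsmul_add (b₈.1 h) n₅ (by simpa using hR 2 1)
  · exact addOrderOf_eq_nine_of_three_nsmul_add (b₄.1 h) n₇ (by simpa using hR 1 2)
  · exact addOrderOf_eq_nine_of_three_nsmul_add (b₃.1 h) n₈ (by simpa using hR 2 2)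

end OrderNine

end Literature.AlgebraicGeometry.PlaneCurves
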